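import Summits.Ventures.HodgeRepro2.T7SupportDominantTermPolynomial
import Summits.Ventures.HodgeRepro2.T7SupportDominantTermNonzero

/-!
# The dominant-term argument with polynomial decay, assembled (support, seat p1)

`exists_tsum_ne_zero_of_polynomial`: in the polynomial-decay / dyadic-grading shapes of
`T7SupportDominantTermPolynomial` (`α > β + d'`), if moreover the weights are absolutely summable at every level
and `b N x0 ≠ 0` for `N` large, then some level has a non-zero sum `∑' x, w N x ≠ 0` — the closing step of
`T7SupportDominantTermNonzero` applied to the polynomial tail bound.

Pure analysis over an abstract index type; nothing here is about any geometric or automorphic object.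
Blind lane: Mathlib + the HodgeRepro2 prefix only; no sorry; axioms ⊆ {propext, Classical.choice, Quot.sound}.
-/

namespace Summit.Ventures.HodgeRepro2.T7SupportDominantTermPolynomialNonzero

open Filter Topology T7SupportDominantTermPolynomial T7SupportDominantTermNonzero

variable {Orb : Type} [DecidableEq Orb]

/-- **The dominant-term argument, polynomial decay, assembled.** -/
theorem exists_tsum_ne_zero_of_polynomial
    (x0 : Orb) (size : Orb → ℝ) (arith : ℕ → Orb → Prop) (a : Orb → ℂ) (b : ℕ → Orb → ℂ)
    (w : ℕ → Orb → ℂ) (hw : ∀ N x, w N x = a x * b N x)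
    (size_nonneg : ∀ x, 0 ≤ size x)
    (b_support : ∀ N x, b N x ≠ 0 → arith N x)
    (α β d' : ℝ) (hβ : 0 ≤ β) (hd' : 0 ≤ d') (hαβ : β + d' < α)
    (a_bound : ∃ C : ℝ, ∀ x, ‖a x‖ ≤ C * (1 + size x) ^ (-α))
    (ρ : ℕ → ℝ) (hρ : Tendsto ρ atTop atTop)
    (size_of_arith : ∀ N x, arith N x → x ≠ x0 → ρ N ≤ size x)
    (count_bound : ∃ C' : ℝ, ∀ N (R : ℝ), 0 ≤ R →
      ∃ s : Finset Orb, (∀ x, arith N x → size x ≤ R → x ∈ s) ∧ (s.card : ℝ) ≤ C' * (1 + R) ^ β)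
    (b_bound : ∃ B : ℝ, ∀ N x, arith N x → ‖b N x‖ ≤ B * (1 + size x) ^ d' * ‖b N x0‖)
    (a_x0 : a x0 ≠ 0)
    (abs_summable : ∀ N, Summable fun x => ‖w N x‖)
    (b_x0 : ∃ N₀ : ℕ, ∀ N ≥ N₀, b N x0 ≠ 0) :
    ∃ N : ℕ, ∑' x, w N x ≠ 0 := by
  obtain ⟨N₁, hN₁⟩ := tail_le_half_of_polynomial x0 size arith a b w hw size_nonneg b_support α β d'
    hβ hd' hαβ a_bound ρ hρ size_of_arith count_bound b_bound a_x0
  obtain ⟨N₀, hN₀⟩ := b_x0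
  refine ⟨max N₀ N₁, ?_⟩
  have hx0 : w (max N₀ N₁) x0 ≠ 0 := by
    rw [hw]
    exact mul_ne_zero a_x0 (hN₀ _ (le_max_left _ _))
  exact tsum_ne_zero_of_tail_le_half x0 (w (max N₀ N₁)) (abs_summable _) hx0
    (hN₁ _ (le_max_right _ _))

end Summit.Ventures.HodgeRepro2.T7SupportDominantTermPolynomialNonzero
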